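import Summits.CriticalPhenomena.PercolationContinuityZ3.Theorems.PercNearOneGluingNoHeavyLowerTailSahiCombMixFiveCellOne
import Summits.CriticalPhenomena.PercolationContinuityZ3.Theorems.PercNearOneGluingNoHeavyLowerTailSahiCombMixFiveCellTwoCoeffs
import Summits.CriticalPhenomena.PercolationContinuityZ3.Theorems.PercNearOneGluingNoHeavyLowerTailSahiCombMixFiveCellThreeA
import Summits.CriticalPhenomena.PercolationContinuityZ3.Theorems.PercNearOneGluingNoHeavyLowerTailSahiCombMixFiveCellThreeB
import Summits.CriticalPhenomena.PercolationContinuityZ3.Theorems.PercNearOneGluingNoHeavyLowerTailSahiCombMixFiveSingleDispatchB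
import Summits.CriticalPhenomena.PercolationContinuityZ3.Theorems.PercNearOneGluingNoHeavyLowerTailSahiCombMixGrow

/-!
# The comb hierarchy for Sahi's `E_k`, LXIX: **THE SINGLE-MEMBER OR STEP AT `n = 5` IS A THEOREM** — the hereditary comb class of five increasing
# events is closed under OR-ing a fresh coordinate into ONE member; growth of quintuples by AND steps and single-member OR steps

Support file of the one-cut programme (crux `NoHeavyLowerTail`, stmt-CriticalPhenomena-4575; cell `prim-masterthm`, seat P3, gen 11;
`run/shared/lean/prim/prim-masterthm/prim-masterthm-p3/HIERARCHY.md` §19).  Gen 10 reduced the single-member OR step at `n = 5` to three canonical order-4 cells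
(`combHereditary_orCoord_five_single_of_three_cells`, `…SahiCombMixFiveSingleDispatchB`); gen 11 proved them (`…FiveCellOne`, `…FiveCellTwoCoeffs`,
`…FiveCellThreeA/B`: explicit `q = 1` certificates whose only multipliers are member moments and their `W_0`-defects).  Here:
* `combFiveSingleCell_two`, `combFiveSingleCell_three` — the cells of classes 173 and 186 assembled from their coefficients (cell 1 = class 159 is
  `combFiveSingleCell_one`);
* **`combHereditary_orCoord_five_single`** — for every finite cube, every quintuple `U` of increasing events ignoring `e` whose ∩-closed family is comb-positive at
  every order (`CombHereditary U`) and every member `i`, the family with `e` OR-ed into `U_i` ALONE is again `CombHereditary`: every row `E_m` of its ∩-closed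
  family is a nonnegative combination of the tensor-Bernstein basis in `p`.  (OR-ing into THREE of five members fails already at the law level —
  `SahiMixture.not_singletonCell_five_three`; into two members only the top cell is known, `combPos_five_orCoord_two`.)
* `hereditaryAllOrders_orCoord_five_single`, `sahiE_five_orCoord_single_nonneg` — law-level shadows under every product measure;
* **`combHereditary_grow_five_single`** — GROWTH AT `n = 5`: a `CombHereditary` quintuple of increasing events determined by `S`, grown by any list of steps on
  pairwise distinct fresh coordinates each of which is either an AND step into ANY sub-collection (`combHereditary_andCoord`, gen 9) or an OR step into at most ONE
  member, stays `CombHereditary`; `sahiE_grow_five_single_nonneg` its law-level shadow.  E.g. five read-once monotone decision lists over a common coordinate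
  order in which every coordinate is an accepting literal of at most one list.
HONEST FRAMING: the one-coordinate induction at `n = 5` for AND steps and single-member OR steps only; H-MIX(5) (OR into ≥ 3 members) is false;
nothing here asserts (M⁺-k) or `C_k` for `k ≥ 3`. [this work]
-/

noncomputable section

open scoped Classical

namespace Summit.CriticalPhenomena.PercolationContinuityZ3.Theorems

open Finset Function
open Literature.Combinatorics.Sahi2008
open Literature.Probability.Percolation (DeterminedBy)
open Literature.Probability.Percolation.DecisionTree (ind ind_of_mem ind_of_not_mem ind_nonneg)
open SahiComb
open SahiCombDisjunct (orCoord)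
open SahiCombHereditary (CombHereditary MixStep grow mixStep andCoord combHereditary_andCoord isUpperSet_grow secAt_grow_of_notMem)

variable {ι : Type} [Fintype ι]

namespace SahiCombMix

/-! ### The two remaining cells, assembled -/

/-- **THE CANONICAL SINGLE-MEMBER CELL 2 IS COMB-POSITIVE** (`CombFiveSingleCell 2`, class 173): for every finite cube, every `CombHereditary` quintuple `W` of
increasing events ignoring `e`, `p ↦ E_4(μ_p; slots)` over the slots `canonSingleK 2` with `e` OR-ed into `W_0` is comb-positive at multidegree `4`
(`combPos_four_mixCoord_of_coeffs`: the end coefficients are hereditary rows off `e`, the middle ones are `combPos_fiveCell2_C1/2/3`). [this work] -/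
theorem combFiveSingleCell_two : CombFiveSingleCell 2 := by
  intro ι _ W e _hWup hWe hW
  have eS : (fun j => ind (⋂ l ∈ canonSingleK 2 j, orCoord W e (sel 0) l))
      = fun j => ind (mixCoord e ((fun j => ⋂ l ∈ canonSingleK 2 j, W l) j)
          ((fun j => ⋂ l ∈ (canonSingleK 2 j).filter (fun l => sel (0 : Fin 5) l = false), W l) j)) := by
    funext j; rw [biInter_orCoord_eq_mixCoord]
  rw [eS]
  refine combPos_four_mixCoord_of_coeffs e (fun j => ⋂ l ∈ canonSingleK 2 j, W l)
    (fun j => ⋂ l ∈ (canonSingleK 2 j).filter (fun l => sel (0 : Fin 5) l = false), W l)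
    (fun j b => secAt_biInter W e hWe _ b) (fun j b => secAt_biInter W e hWe _ b)
    (fun j => Set.biInter_subset_biInter_left (Finset.filter_subset _ _)) ?_ ?_ ?_ ?_ ?_
  · exact hW.row_off e hWe 4 (canonSingleK 2)
  · exact combPos_fiveCell2_C1 W e hWe hW
  · exact combPos_fiveCell2_C2 W e hWe hW
  · exact combPos_fiveCell2_C3 W e hWe hW
  · exact hW.row_off e hWe 4 (fun j => (canonSingleK 2 j).filter (fun l => sel (0 : Fin 5) l = false))

/-- **THE CANONICAL SINGLE-MEMBER CELL 3 IS COMB-POSITIVE** (`CombFiveSingleCell 3`, class 186): for every finite cube, every `CombHereditary` quintuple `W` of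
increasing events ignoring `e`, `p ↦ E_4(μ_p; slots)` over the slots `canonSingleK 3` with `e` OR-ed into `W_0` is comb-positive at multidegree `4`
(`combPos_four_mixCoord_of_coeffs`: the end coefficients are hereditary rows off `e`, the middle ones are `combPos_fiveCell3_C1/2/3`). [this work] -/
theorem combFiveSingleCell_three : CombFiveSingleCell 3 := by
  intro ι _ W e _hWup hWe hW
  have eS : (fun j => ind (⋂ l ∈ canonSingleK 3 j, orCoord W e (sel 0) l))
      = fun j => ind (mixCoord e ((fun j => ⋂ l ∈ canonSingleK 3 j, W l) j)
          ((fun j => ⋂ l ∈ (canonSingleK 3 j).filter (fun l => sel (0 : Fin 5) l = false), W l) j)) := by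
    funext j; rw [biInter_orCoord_eq_mixCoord]
  rw [eS]
  refine combPos_four_mixCoord_of_coeffs e (fun j => ⋂ l ∈ canonSingleK 3 j, W l)
    (fun j => ⋂ l ∈ (canonSingleK 3 j).filter (fun l => sel (0 : Fin 5) l = false), W l)
    (fun j b => secAt_biInter W e hWe _ b) (fun j b => secAt_biInter W e hWe _ b)
    (fun j => Set.biInter_subset_biInter_left (Finset.filter_subset _ _)) ?_ ?_ ?_ ?_ ?_
  · exact hW.row_off e hWe 4 (canonSingleK 3)
  · exact combPos_fiveCell3_C1 W e hWe hW
  · exact combPos_fiveCell3_C2 W e hWe hW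
  · exact combPos_fiveCell3_C3 W e hWe hW
  · exact hW.row_off e hWe 4 (fun j => (canonSingleK 3 j).filter (fun l => sel (0 : Fin 5) l = false))

/-! ### The single-member OR step at `n = 5` -/

/-- **THE SINGLE-MEMBER OR STEP AT `n = 5`.**  For every finite cube, every quintuple `U` of increasing events ignoring `e` with `CombHereditary U` and every member
`i`: OR-ing the coordinate event `{e ∈ ω}` into `U_i` alone gives again a `CombHereditary` family. [this work] -/
theorem combHereditary_orCoord_five_single (U : Fin 5 → Set (Set ι)) (e : ι) (i : Fin 5) (hUup : ∀ j, IsUpperSet (U j))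
    (hUe : ∀ (j : Fin 5) (b : Bool), secAt e b (U j) = U j) (hU : CombHereditary U) : CombHereditary (orCoord U e (sel i)) :=
  combHereditary_orCoord_five_single_of_three_cells combFiveSingleCell_one combFiveSingleCell_two combFiveSingleCell_three U e i hUup hUe hU

/-- Law-level shadow: every row of the ∩-closed family of `(U_0,…,U_i ∪ {e∈ω},…,U_4)` is nonnegative under every product measure. [this work] -/
theorem hereditaryAllOrders_orCoord_five_single (U : Fin 5 → Set (Set ι)) (e : ι) (i : Fin 5) (hUup : ∀ j, IsUpperSet (U j))
    (hUe : ∀ (j : Fin 5) (b : Bool), secAt e b (U j) = U j) (hU : CombHereditary U) (p : ι → unitInterval) :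
    SahiMixture.HereditaryAllOrders (bernoulliWeight p) (orCoord U e (sel i)) :=
  (combHereditary_orCoord_five_single U e i hUup hUe hU).hereditaryAllOrders p

/-- In particular `E_5(μ_p; U_0,…,U_i ∪ {e∈ω},…,U_4) ≥ 0` under every product measure. [this work] -/
theorem sahiE_five_orCoord_single_nonneg (U : Fin 5 → Set (Set ι)) (e : ι) (i : Fin 5) (hUup : ∀ j, IsUpperSet (U j))
    (hUe : ∀ (j : Fin 5) (b : Bool), secAt e b (U j) = U j) (hU : CombHereditary U) (p : ι → unitInterval) :
    0 ≤ sahiE (bernoulliWeight p) 5 (fun j => ind (orCoord U e (sel i) j)) :=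
  ((combHereditary_orCoord_five_single U e i hUup hUe hU).combAllOrders 5 id).nonneg p

/-! ### Growth at `n = 5`: AND steps into any sub-collection, OR steps into at most one member -/

/-- **GROWING FIVE HEREDITARILY COMB-POSITIVE EVENTS.**  Let `U_0,…,U_4` be increasing, determined by the coordinate set `S`, with `CombHereditary U`.  Every step list
reading pairwise distinct coordinates outside `S`, whose AND steps select arbitrary sub-collections and whose OR steps select at most ONE member each
(`s.sel = sel i`), grows `U` into a `CombHereditary` family. [this work] -/
theorem combHereditary_grow_five_single {U : Fin 5 → Set (Set ι)} (hUup : ∀ j, IsUpperSet (U j)) {S : Set ι} (hUS : ∀ j, DeterminedBy (U j) S)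
    (hU : CombHereditary U) :
    ∀ (L : List (MixStep ι 5)), (L.map MixStep.coord).Nodup → (∀ s ∈ L, s.coord ∉ S) → (∀ s ∈ L, s.op = true → ∃ i, s.sel = sel i) →
      CombHereditary (grow U L)
  | [], _, _, _ => hU
  | s :: L, hL, hS, h1 => by
    rw [List.map_cons, List.nodup_cons] at hL
    have ih := combHereditary_grow_five_single hUup hUS hU L hL.2 (fun t ht => hS t (List.mem_cons_of_mem s ht))
      fun t ht => h1 t (List.mem_cons_of_mem s ht)
    have hup := isUpperSet_grow hUup L
    have hig := secAt_grow_of_notMem hUS L (hS s List.mem_cons_self) hL.1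
    show CombHereditary (mixStep (grow U L) s)
    unfold mixStep
    cases hop : s.op
    · exact combHereditary_andCoord _ s.coord s.sel hig ih
    · obtain ⟨i, hi⟩ := h1 s List.mem_cons_self hop
      rw [hi]
      exact combHereditary_orCoord_five_single _ s.coord i hup hig ih

/-- Law-level shadow of `combHereditary_grow_five_single`: all rows of the grown quintuple are nonnegative under every product measure. [this work] -/
theorem sahiE_grow_five_single_nonneg {U : Fin 5 → Set (Set ι)} (hUup : ∀ j, IsUpperSet (U j)) {S : Set ι} (hUS : ∀ j, DeterminedBy (U j) S)
    (hU : CombHereditary U) (L : List (MixStep ι 5)) (hL : (L.map MixStep.coord).Nodup) (hS : ∀ s ∈ L, s.coord ∉ S)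
    (h1 : ∀ s ∈ L, s.op = true → ∃ i, s.sel = sel i) (p : ι → unitInterval) (m : ℕ) (K : Fin m → Finset (Fin 5)) :
    0 ≤ sahiE (bernoulliWeight p) m (fun j => ind (⋂ i ∈ K j, grow U L i)) :=
  ((combHereditary_grow_five_single hUup hUS hU L hL hS h1).hereditaryAllOrders p) m K

end SahiCombMix

end Summit.CriticalPhenomena.PercolationContinuityZ3.Theorems

end
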